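import Mathlib

/-!
# A two-generator effective bialgebra in which fullness and semisimplicity fail before inverting
# the Lefschetz element (solo-blind s69)

Kernel certificate of the toy model of `paper/inj-sectors.md` §7 (session s68, claim C660).  In the
notes, `A^eff_Nori` is a commutative bialgebra, `ς` the coefficient of the Lefschetz motive `𝕃`,
`O(G_mot) = A^eff[ς⁻¹]`, and the open statement `Inj` ("effective Nori motives embed fully, with
subquotient-closed image, into all Nori motives") is equivalent to `ς` being a non-zero-divisor.  The
toy shows that NOTHING in the bialgebra formalism forces this: here is a commutative bialgebra with a
group-like element `g` (playing `ς`) that IS a zero-divisor, together with a 2-dimensional comodule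
whose endomorphism algebra, subobjects and (semi)simplicity all change when `g` is inverted.

The bialgebra: `A = ℚ[g, x] / (x², g·x)` (`A`, `g`, `x`), `Δ g = g ⊗ g`, `Δ x = g ⊗ x + x ⊗ g`,
`ε g = 1`, `ε x = 0` (`comul`, `counit`, constructed from the universal property `pointHom`:
ring maps `A → R` are the pairs `(γ, ξ) ∈ R²` with `ξ² = 0`, `γ ξ = 0`).  Functor-of-points form: the
affine monoid `M = Spec A` has `M(R) = {(γ, ξ) : ξ² = γξ = 0}`, a submonoid of the multiplicative
monoid of dual numbers (`mem_mul`: the product is `(γγ', γξ' + ξγ')`), with unit group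
`D(g) = {(γ, 0) : γ ∈ Rˣ} = 𝔾_m` (`snd_eq_zero_of_isUnit`).
* `g_mul_x`, `x_ne_zero`, `g_ne_zero`: `g` is a zero-divisor; `map_x_eq_zero_of_isUnit`: `x` dies
  under every ring map inverting `g` — so `D(g)` is not schematically dense in `M`
  (the analogue of `¬ Inj`).
* The comodule `V = ℚ²` (`v₁ ↦ v₁ ⊗ g`, `v₂ ↦ v₂ ⊗ g + v₁ ⊗ x`) is the representation
  `ρ(γ, ξ) = !![γ, ξ; 0, γ]` (`rho`, `rho_mul`, `rho_one`).  MONOID SIDE: the commutant of `ρ` over all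
  points is `{!![a, b; 0, a]} = {ρ(a,b)} ≅ ℚ[n]/(n²)` (`commute_eps_point_iff`, `rho_comm`), it contains
  the non-zero nilpotent `N = ρ(0,1)` (`N_sq`, `N_ne_zero`) and no idempotent other than `0, 1`
  (`idempotent_trivial`): `V` is indecomposable and not semisimple, and the line `ℚ·v₂` is not
  `M`-stable (`line_not_stable`).  GROUP SIDE: `ρ(γ, 0) = γ • 1` commutes with everything
  (`commute_unit_point`), the idempotent `E = !![0,0;0,1]` splits `V|_{𝔾_m} = χ ⊕ χ`
  (`E_commutes_units`, `E_not_in_commutant`), End `= M₂(ℚ)`.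
So fullness (`ℚ[n]/(n²) ≠ M₂(ℚ)`), subobject-closure and semisimplicity all fail on the effective
(monoid) side and hold on the group side: any proof of `Inj` must use geometry (algebraic cycles act
with a one-sided twist, FACT Ch of the notes), not the formalism.  Bearing on the summit: none
directly (it certifies that a named would-be shortcut is void).
-/

open MvPolynomial TrivSqZeroExt DualNumber Matrix
open scoped TensorProduct

namespace Summit.KontsevichZagierPeriods.KontsevichZagierPeriods.Theorems
namespace SoloBlind
namespace ToyEffectiveBialgebra

/-! ### The algebra `A = ℚ[g, x]/(x², gx)` and its points -/

/-- The ideal `(x², g x)` of `ℚ[g, x]` (`g = X 0`, `x = X 1`). -/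
noncomputable def rel : Ideal (MvPolynomial (Fin 2) ℚ) :=
  Ideal.span {X 1 ^ 2, X 0 * X 1}

/-- `A = ℚ[g, x] / (x², g x)`. -/
abbrev A : Type := MvPolynomial (Fin 2) ℚ ⧸ rel

/-- The group-like generator `g` (the toy Lefschetz coefficient `ς`). -/
noncomputable def g : A := Ideal.Quotient.mk rel (X 0)

/-- The `g`-primitive generator `x`. -/
noncomputable def x : A := Ideal.Quotient.mk rel (X 1)

/-- `x² = 0` in `A`. -/
theorem x_mul_x : x * x = 0 := by
  rw [x, ← map_mul, Ideal.Quotient.eq_zero_iff_mem, ← sq]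
  exact Ideal.subset_span (by simp)

/-- `g x = 0` in `A`: `g` is a zero-divisor once `x ≠ 0` is known (`x_ne_zero`). -/
theorem g_mul_x : g * x = 0 := by
  rw [g, x, ← map_mul, Ideal.Quotient.eq_zero_iff_mem]
  exact Ideal.subset_span (by simp)

/-- `x g = 0`. -/
theorem x_mul_g : x * g = 0 := by rw [mul_comm, g_mul_x]

section points

variable {R : Type*} [CommRing R] [Algebra ℚ R]

/-- The relations hold at every pair `(γ, ξ)` with `ξ² = 0`, `γ ξ = 0`. -/
theorem rel_le_ker (γ ξ : R) (h1 : ξ * ξ = 0) (h2 : γ * ξ = 0) :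
    rel ≤ RingHom.ker ((MvPolynomial.aeval ![γ, ξ] : MvPolynomial (Fin 2) ℚ →ₐ[ℚ] R) :
      MvPolynomial (Fin 2) ℚ →+* R) := by
  rw [rel, Ideal.span_le]
  intro p hp
  simp only [Set.mem_insert_iff, Set.mem_singleton_iff] at hp
  rcases hp with rfl | rfl
  · simp [RingHom.mem_ker, sq, h1]
  · simp [RingHom.mem_ker, h2]

/-- UNIVERSAL PROPERTY (existence): every `(γ, ξ) ∈ M(R) = {ξ² = 0, γξ = 0}` is a point of `Spec A`,
i.e. gives the algebra map `A → R`, `g ↦ γ`, `x ↦ ξ`. -/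
noncomputable def pointHom (γ ξ : R) (h1 : ξ * ξ = 0) (h2 : γ * ξ = 0) : A →ₐ[ℚ] R :=
  Ideal.Quotient.liftₐ rel (MvPolynomial.aeval ![γ, ξ]) (fun _ ha => rel_le_ker γ ξ h1 h2 ha)

/-- `pointHom` sends `g ↦ γ`. -/
@[simp] theorem pointHom_g (γ ξ : R) (h1 : ξ * ξ = 0) (h2 : γ * ξ = 0) :
    pointHom γ ξ h1 h2 g = γ := by
  simp [pointHom, g, Ideal.Quotient.liftₐ_apply, Ideal.Quotient.lift_mk]

/-- `pointHom` sends `x ↦ ξ`. -/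
@[simp] theorem pointHom_x (γ ξ : R) (h1 : ξ * ξ = 0) (h2 : γ * ξ = 0) :
    pointHom γ ξ h1 h2 x = ξ := by
  simp [pointHom, x, Ideal.Quotient.liftₐ_apply, Ideal.Quotient.lift_mk]

omit [Algebra ℚ R] in
/-- UNIVERSAL PROPERTY (relations): conversely every ring map `φ : A → R` lands in `M(R)`. -/
theorem point_rel (φ : A →+* R) : φ x * φ x = 0 ∧ φ g * φ x = 0 := by
  constructor
  · rw [← map_mul, x_mul_x, map_zero]
  · rw [← map_mul, g_mul_x, map_zero]

omit [Algebra ℚ R] in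
/-- `D(g) = 𝔾_m`: at a point where `g` is a unit, `x` vanishes.  Hence `x`, a NON-ZERO function on `M`
(`x_ne_zero`), vanishes identically on the open unit group `D(g)`: `D(g)` is not schematically dense
in `M` — the toy `¬ Inj`. -/
theorem map_x_eq_zero_of_isUnit (φ : A →+* R) (hu : IsUnit (φ g)) : φ x = 0 := by
  have h : φ g * φ x = φ g * 0 := by rw [mul_zero, ← map_mul, g_mul_x, map_zero]
  exact hu.mul_left_cancel h

omit [Algebra ℚ R] in
/-- The points of `M` form a submonoid of the multiplicative monoid of dual numbers over `R`:
`(γ, ξ)·(γ', ξ') = (γγ', γξ' + ξγ')` stays in `M(R)`.  (This is the comultiplication `Δ g = g ⊗ g`,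
`Δ x = g ⊗ x + x ⊗ g` in functor-of-points form.) -/
theorem mem_mul {γ ξ γ' ξ' : R} (h1 : ξ * ξ = 0) (h2 : γ * ξ = 0) (h1' : ξ' * ξ' = 0)
    (h2' : γ' * ξ' = 0) :
    (γ * ξ' + ξ * γ') * (γ * ξ' + ξ * γ') = 0 ∧ (γ * γ') * (γ * ξ' + ξ * γ') = 0 := by
  constructor
  · have e : (γ * ξ' + ξ * γ') * (γ * ξ' + ξ * γ') =
        γ * γ * (ξ' * ξ') + 2 * (γ * ξ) * (γ' * ξ') + γ' * γ' * (ξ * ξ) := by ring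
    rw [e, h1, h2, h1']; ring
  · have e : (γ * γ') * (γ * ξ' + ξ * γ') = γ * γ * (γ' * ξ') + γ' * γ' * (γ * ξ) := by ring
    rw [e, h2, h2']; ring

omit [Algebra ℚ R] in
/-- In `M(R)` a unit first coordinate forces the second to vanish: the unit group of the monoid
`M(R)` is `{(γ, 0) : γ ∈ Rˣ} = 𝔾_m(R)`. -/
theorem snd_eq_zero_of_isUnit {γ ξ : R} (h2 : γ * ξ = 0) (hu : IsUnit γ) : ξ = 0 :=
  hu.mul_left_cancel (h2.trans (mul_zero γ).symm)

end points

/-- `x ≠ 0` in `A`: the point `(0, ε)` of `M(ℚ[ε])` sends `x ↦ ε ≠ 0`.  With `g_mul_x`: `g` is a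
zero-divisor of `A`. -/
theorem x_ne_zero : x ≠ 0 := by
  intro h
  have h1 : (ε : ℚ[ε]) * ε = 0 := eps_mul_eps
  have h2 : (0 : ℚ[ε]) * ε = 0 := zero_mul _
  have := pointHom_x (0 : ℚ[ε]) ε h1 h2
  rw [h, map_zero] at this
  have := congrArg TrivSqZeroExt.snd this
  simp [DualNumber.snd_eps] at this

/-- `g ≠ 0` in `A` (the point `(1, 0)` of `M(ℚ)`). -/
theorem g_ne_zero : g ≠ 0 := by
  intro h
  have := pointHom_g (1 : ℚ) 0 (mul_zero 0) (mul_zero 1)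
  rw [h, map_zero] at this
  exact zero_ne_one this

/-- `g` is a zero-divisor of `A` (so `A → A[g⁻¹]` is not injective). -/
theorem g_zero_divisor : ∃ y : A, y ≠ 0 ∧ g * y = 0 := ⟨x, x_ne_zero, g_mul_x⟩

/-! ### The bialgebra structure maps -/

/-- `(g ⊗ x + x ⊗ g)² = 0` in `A ⊗ A`. -/
theorem comul_rel₁ :
    ((g ⊗ₜ[ℚ] x + x ⊗ₜ[ℚ] g : A ⊗[ℚ] A) * (g ⊗ₜ[ℚ] x + x ⊗ₜ[ℚ] g)) = 0 := by
  have e : ∀ p q : A ⊗[ℚ] A, (p + q) * (p + q) = p * p + p * q + q * p + q * q :=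
    fun p q => by ring
  rw [e, Algebra.TensorProduct.tmul_mul_tmul, Algebra.TensorProduct.tmul_mul_tmul,
    Algebra.TensorProduct.tmul_mul_tmul, Algebra.TensorProduct.tmul_mul_tmul, x_mul_x, g_mul_x,
    x_mul_g]
  simp only [TensorProduct.tmul_zero, TensorProduct.zero_tmul, add_zero]

/-- `(g ⊗ g)(g ⊗ x + x ⊗ g) = 0` in `A ⊗ A`. -/
theorem comul_rel₂ :
    ((g ⊗ₜ[ℚ] g : A ⊗[ℚ] A) * (g ⊗ₜ[ℚ] x + x ⊗ₜ[ℚ] g)) = 0 := by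
  have e : ∀ p q r : A ⊗[ℚ] A, r * (p + q) = r * p + r * q := fun p q r => by ring
  rw [e, Algebra.TensorProduct.tmul_mul_tmul, Algebra.TensorProduct.tmul_mul_tmul, g_mul_x]
  simp only [TensorProduct.tmul_zero, TensorProduct.zero_tmul, add_zero]

/-- The comultiplication `Δ : A → A ⊗ A`, `g ↦ g ⊗ g`, `x ↦ g ⊗ x + x ⊗ g` — it exists because
`(g ⊗ g, g ⊗ x + x ⊗ g)` is a point of `M(A ⊗ A)` (`comul_rel₁`, `comul_rel₂`). -/
noncomputable def comul : A →ₐ[ℚ] A ⊗[ℚ] A :=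
  pointHom (R := A ⊗[ℚ] A) (g ⊗ₜ[ℚ] g) (g ⊗ₜ[ℚ] x + x ⊗ₜ[ℚ] g) comul_rel₁ comul_rel₂

/-- `Δ g = g ⊗ g` (`g` is group-like). -/
theorem comul_g : comul g = g ⊗ₜ[ℚ] g := by
  rw [comul, pointHom_g]

/-- `Δ x = g ⊗ x + x ⊗ g` (`x` is `g`-primitive). -/
theorem comul_x : comul x = g ⊗ₜ[ℚ] x + x ⊗ₜ[ℚ] g := by
  rw [comul, pointHom_x]

/-- The counit `ε : A → ℚ`, `g ↦ 1`, `x ↦ 0` (the unit point `(1, 0)`). -/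
noncomputable def counit : A →ₐ[ℚ] ℚ := pointHom (R := ℚ) 1 0 (mul_zero 0) (mul_zero 1)

/-- `ε g = 1`. -/
theorem counit_g : counit g = 1 := by
  rw [counit, pointHom_g]

/-- `ε x = 0`. -/
theorem counit_x : counit x = 0 := by
  rw [counit, pointHom_x]

/-! ### The two-dimensional representation `ρ(γ, ξ) = !![γ, ξ; 0, γ]` -/

section rep

variable {R : Type*} [CommRing R]

/-- The representation matrix of the comodule `V` at the point `(γ, ξ)`. -/
def rho (γ ξ : R) : Matrix (Fin 2) (Fin 2) R := !![γ, ξ; 0, γ]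

/-- `ρ` is multiplicative for the monoid law of `M` (indeed of all dual numbers). -/
theorem rho_mul (γ ξ γ' ξ' : R) : rho γ ξ * rho γ' ξ' = rho (γ * γ') (γ * ξ' + ξ * γ') := by
  simp [rho]

/-- `ρ(1, 0) = 1`. -/
theorem rho_one : rho (1 : R) 0 = 1 := by
  rw [rho, Matrix.one_fin_two]

/-- Any two `ρ`-matrices commute (so `{ρ(a, b)}` lies in the commutant of `ρ`). -/
theorem rho_comm (γ ξ γ' ξ' : R) : rho γ ξ * rho γ' ξ' = rho γ' ξ' * rho γ ξ := by
  rw [rho_mul, rho_mul]; congr 1 <;> ring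

/-- On the unit group, `ρ(γ, 0) = γ • 1` is scalar. -/
theorem rho_unit (γ : R) : rho γ 0 = γ • (1 : Matrix (Fin 2) (Fin 2) R) := by
  ext i j; fin_cases i <;> fin_cases j <;> simp [rho]

/-- GROUP SIDE: every matrix commutes with every `ρ(γ, 0)` — after inverting `g` the commutant is
all of `M₂` (`End_{𝔾_m}(χ ⊕ χ) = M₂(ℚ)`). -/
theorem commute_unit_point (T : Matrix (Fin 2) (Fin 2) R) (γ : R) :
    T * rho γ 0 = rho γ 0 * T := by
  rw [rho_unit, Matrix.mul_smul, Matrix.smul_mul, mul_one, one_mul]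

end rep

/-- `inl a · ε = a • ε` in `ℚ[ε]`. -/
theorem inl_mul_eps (a : ℚ) : (inl a : ℚ[ε]) * ε = a • ε := by
  show (inl a : TrivSqZeroExt ℚ ℚ) * (inr 1 : TrivSqZeroExt ℚ ℚ) = _
  rw [inl_mul_inr, smul_eq_mul, mul_one, inr_eq_smul_eps]

/-- `ε · inl a = a • ε` in `ℚ[ε]`. -/
theorem eps_mul_inl (a : ℚ) : ε * (inl a : ℚ[ε]) = a • ε := by
  rw [mul_comm, inl_mul_eps]

/-- `snd (a • ε) = a`. -/
theorem snd_smul_eps (a : ℚ) : (a • ε : ℚ[ε]).snd = a := by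
  simp [DualNumber.snd_eps]

/-- MONOID SIDE: a rational matrix commutes with `ρ` at the point `(0, ε) ∈ M(ℚ[ε])` iff it is of the
form `!![a, b; 0, a]`. -/
theorem commute_eps_point_iff (T : Matrix (Fin 2) (Fin 2) ℚ) :
    T.map (algebraMap ℚ ℚ[ε]) * rho 0 ε = rho 0 ε * T.map (algebraMap ℚ ℚ[ε]) ↔
      T 1 0 = 0 ∧ T 0 0 = T 1 1 := by
  have e : T.map (algebraMap ℚ ℚ[ε]) = !![inl (T 0 0), inl (T 0 1); inl (T 1 0), inl (T 1 1)] :=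
    Matrix.ext fun i j => by
      rw [Matrix.map_apply, algebraMap_eq_inl]
      fin_cases i <;> fin_cases j <;> rfl
  rw [e, rho, Matrix.mul_fin_two, Matrix.mul_fin_two]
  simp only [mul_zero, zero_mul, add_zero, zero_add, inl_mul_eps, eps_mul_inl]
  constructor
  · intro h
    have h00 := congrArg (fun M : Matrix (Fin 2) (Fin 2) ℚ[ε] => (M 0 0).snd) h
    have h01 := congrArg (fun M : Matrix (Fin 2) (Fin 2) ℚ[ε] => (M 0 1).snd) h
    simp only [Matrix.of_apply, Matrix.cons_val', Matrix.cons_val_zero, Matrix.cons_val_one,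
      Matrix.cons_val_fin_one, Matrix.empty_val', snd_zero, snd_smul_eps] at h00 h01
    exact ⟨h00.symm, h01⟩
  · rintro ⟨h10, h00⟩
    simp only [h10, h00, zero_smul]

/-- … and a matrix of that form commutes with `ρ(γ, ξ)` at EVERY point of every `R`
(it is `ρ(a, b)` itself).  So the commutant of the comodule `V` is `{ρ(a, b)} ≅ ℚ[n]/(n²)`. -/
theorem commute_all_points {T : Matrix (Fin 2) (Fin 2) ℚ} (h10 : T 1 0 = 0) (h00 : T 0 0 = T 1 1)
    {R : Type*} [CommRing R] [Algebra ℚ R] (γ ξ : R) :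
    T.map (algebraMap ℚ R) * rho γ ξ = rho γ ξ * T.map (algebraMap ℚ R) := by
  have e : T.map (algebraMap ℚ R) = rho (algebraMap ℚ R (T 1 1)) (algebraMap ℚ R (T 0 1)) := by
    ext i j; fin_cases i <;> fin_cases j <;> simp [rho, h10, h00]
  rw [e, rho_comm]

/-- The commutant as a set of rational matrices is exactly `{ρ(a, b) : a, b ∈ ℚ}`. -/
theorem commutant_eq (T : Matrix (Fin 2) (Fin 2) ℚ) :
    (T 1 0 = 0 ∧ T 0 0 = T 1 1) ↔ ∃ a b : ℚ, T = rho a b := by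
  constructor
  · rintro ⟨h10, h00⟩
    refine ⟨T 1 1, T 0 1, ?_⟩
    ext i j; fin_cases i <;> fin_cases j <;> simp [rho, h10, h00]
  · rintro ⟨a, b, rfl⟩
    simp [rho]

/-- The nilpotent endomorphism `N = ρ(0, 1)` of the comodule `V`. -/
def N : Matrix (Fin 2) (Fin 2) ℚ := rho 0 1

/-- `N² = 0`. -/
theorem N_sq : N * N = 0 := by
  rw [N, rho_mul]; ext i j; fin_cases i <;> fin_cases j <;> simp [rho]

/-- `N ≠ 0`: the commutant `ℚ[n]/(n²)` of `V` has a non-zero nilpotent, so it is not a semisimple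
algebra and `V` is not a semisimple comodule. -/
theorem N_ne_zero : N ≠ 0 := by
  intro h
  have := congrArg (fun M : Matrix (Fin 2) (Fin 2) ℚ => M 0 1) h
  simp [N, rho] at this

/-- `N` lies in the commutant (`N = ρ(0,1)`). -/
theorem N_mem_commutant : N 1 0 = 0 ∧ N 0 0 = N 1 1 := by simp [N, rho]

/-- The only idempotents of the commutant `{ρ(a, b)}` are `0` and `1`: `V` is INDECOMPOSABLE as a
comodule over `A` (a non-split self-extension of the simple comodule `χ : v ↦ v ⊗ g`). -/
theorem idempotent_trivial (a b : ℚ) (h : rho a b * rho a b = rho a b) :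
    rho a b = 0 ∨ rho a b = 1 := by
  rw [rho_mul] at h
  have ha : a * a = a := congrArg (fun M : Matrix (Fin 2) (Fin 2) ℚ => M 0 0) h
  have hb : a * b + b * a = b := congrArg (fun M : Matrix (Fin 2) (Fin 2) ℚ => M 0 1) h
  have ha' : a = 0 ∨ a = 1 := by
    have : a * (a - 1) = 0 := by rw [mul_sub, mul_one, ha, sub_self]
    rcases mul_eq_zero.1 this with h0 | h1
    · exact Or.inl h0
    · exact Or.inr (sub_eq_zero.1 h1)
  rcases ha' with rfl | rfl
  · left
    have hb0 : b = 0 := by linarith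
    subst hb0
    ext i j; fin_cases i <;> fin_cases j <;> simp [rho]
  · right
    have hb0 : b = 0 := by linarith
    subst hb0
    exact rho_one

/-- GROUP SIDE: the idempotent `E = !![0, 0; 0, 1]` commutes with every `ρ(γ, 0)`, so over the unit
group `V` splits as `χ ⊕ χ` … -/
theorem E_commutes_units {R : Type*} [CommRing R] (γ : R) :
    (!![0, 0; 0, 1] : Matrix (Fin 2) (Fin 2) R) * rho γ 0 = rho γ 0 * !![0, 0; 0, 1] :=
  commute_unit_point _ γ

/-- … but `E` is NOT in the commutant of the comodule (`E 0 0 ≠ E 1 1`): the splitting does not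
exist before inverting `g` (fullness fails: `ℚ[n]/(n²) ≠ M₂(ℚ)`). -/
theorem E_not_in_commutant :
    ¬ ((!![0, 0; 0, 1] : Matrix (Fin 2) (Fin 2) ℚ) 1 0 = 0 ∧
        (!![0, 0; 0, 1] : Matrix (Fin 2) (Fin 2) ℚ) 0 0 = (!![0, 0; 0, 1] : Matrix _ _ ℚ) 1 1) := by
  simp

/-- SUBOBJECTS: the line `ℚ·v₂` is stable under every `ρ(γ, 0)` (a `𝔾_m`-subrepresentation) … -/
theorem line_stable_units {R : Type*} [CommRing R] (γ : R) :
    rho γ 0 *ᵥ ![0, 1] = γ • ![0, 1] := by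
  ext i; fin_cases i <;> simp [rho, Matrix.mulVec, dotProduct, Fin.sum_univ_two]

/-- … but NOT under the point `(0, ε)`: `ρ(0, ε) v₂ = ε v₁ ∉ ℚ[ε]·v₂`.  So the image of `V` on the group
side has a subobject that does not come from the monoid side (subquotient-closure fails). -/
theorem line_not_stable : ¬ ∃ c : ℚ[ε], rho (0 : ℚ[ε]) ε *ᵥ ![0, 1] = c • ![0, 1] := by
  rintro ⟨c, hc⟩
  have h0 := congrArg (fun v : Fin 2 → ℚ[ε] => (v 0).snd) hc
  simp [rho, Matrix.mulVec, dotProduct, Fin.sum_univ_two, DualNumber.snd_eps] at h0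

/-- The invariant line `ℚ·v₁` IS a subcomodule: `ρ(γ, ξ) v₁ = γ v₁` at every point. -/
theorem line_one_stable {R : Type*} [CommRing R] (γ ξ : R) :
    rho γ ξ *ᵥ ![1, 0] = γ • ![1, 0] := by
  ext i; fin_cases i <;> simp [rho, Matrix.mulVec, dotProduct, Fin.sum_univ_two]

end ToyEffectiveBialgebra
end SoloBlind
end Summit.KontsevichZagierPeriods.KontsevichZagierPeriods.Theorems
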